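import Summits.QuantumFields.BalabanUV.T4Continuum.Support.NE7SliceTheoremNL0Curved
import Summits.QuantumFields.BalabanUV.T4Continuum.Support.NE7SliceRepresentativeNL0Budget
import Summits.QuantumFields.BalabanUV.T4Continuum.Support.NE7SliceRepresentative
import Summits.QuantumFields.BalabanUV.T4Continuum.Support.NE3TopRadiusLetters
import Summits.QuantumFields.BalabanUV.T4Continuum.Support.NE3ClassRadiusFamily
import Summits.QuantumFields.BalabanUV.T4Continuum.Support.NE3CovariantLineSumsError
import Summits.QuantumFields.BalabanUV.T4Continuum.Support.ShellMeasureAverageProp4General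
import Summits.QuantumFields.BalabanUV.T4Continuum.Support.NE7HdecompOfTopNormalised
import HarnessLib

/-!
# NE7SliceRepresentativeNL0 — THE (R1″) REPRESENTATIVE OF A PAIR IN THE END's CURRENCIES, ONE SMALLNESS HYPOTHESIS (memo ROAD-G103 §7 (J3)): at dimension `d+1 ≥ 2`, `L ≥ 2`, radius
# `x = ε∕M²` (`M = L^{k+1}`) for both configurations and a near-representative `‖W(b)⁻¹U′^{u₀}(b) − 1‖ ≤ b̂·M·(ε∕M²)`, there are k-FREE `ε₂ > 0`, `C_S > 0`, `α₀ > 0` such that `0 < ε ≤ ε₂` alone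
# gives the (R1″) representative `u⋆` of `NE7SliceTheoremNL0Curved.slice_theorem_curved_nl0` — chart `U′^{u⋆} = W·e^{X⋆}`, `M·‖X⋆‖ ≤ C_S·ε`, corners `e^{h⋆}` with `‖h⋆‖ ≤ C_S·ε`, the slice condition
# `X⋆ − R₀ φ̃⋆ ∈ 𝒯_E(W)` and **(1.37) EXACTLY `mlog v_{k+1}(X⋆) = h⋆`** — together with every class∕regime fact the direct letters `NE7SliceDirectLettersNL0` and the `R₀`-letters
# `NE7FrameFreeRightInverseLetters` consume at this pair (the tower class, `cruxC`∕`thetaLoc`∕`M²x` lines, the def-parameter `hE` of `R₀`, [B7]'s Prop-4 regime at the radius `C_S·ε∕M`: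
# `pdev W < α₀∕M²`, the exponential line, `4C_Sε ≤ c3`, `2048(d+1)C_Sε ≤ 1`, the `hK` line and the ℓ¹ level line `hS1`) — EVERY numeric line DISCHARGED by the budget `NE7SliceRepresentativeNL0Budget.budget_nl0`

Cell `pub-balaban`, rung (B)+1 sub-cell t4, lineage `b2b-balaban-t4-ne7-p1`, generation 104 (CRUX PROVER NE7 #1 = OWNER of BINDER row NE7).  Memo `t4/b2b-balaban-t4-ne7-p1-g103/ROAD-G103.md` §7.  The pattern of
`NE7SliceRepresentativeFrames.slice_representative_fm` (gen 102) for the frame-free engine; row NE3's class-radius letters (`levelSmall_pair`, `thetaP_line`, `curvSum_line`, `radius_levels`,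
`radIter_radSum_le_of_small`) BY NAME.
WHAT ([folklore]; 0 def, 0 sorry).  `supCurlC0_nonneg`, `c2'_pos`, **`slice_representative_nl0`** (statement displayed).
HONEST FRAMING (page 1): real-number bookkeeping over landed kernel theorems; the constants are existential and k-free; nothing of Bałaban's asserted; NOT `hdecomp♭` (the junction is the next file), NOT NE7;
spine 0∕9; finite T⁴ rung (B)+1 — NOT infinite volume, NOT mass gap, NOT BetaPertH, NOT Clay (continuum YM on T⁴ ⇐ BetaPertH ∧ nine spine estimates, 0/9 proved).
-/

set_option autoImplicit false

open scoped BigOperators Matrix.Norms.L2Operator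
open NormedSpace Finset

namespace Summit.QuantumFields.BalabanUV.T4Continuum.NE7SliceRepresentativeNL0

open Literature.MathematicalPhysics.QuantumFieldTheory.Balaban1983to89
open B7Prop1Explicit B7Prop2Explicit B7Prop3Flat MatrixLog
open B7Eq92Concrete (vcov)
open T4AveragingDeficitWall (IsUnitaryCfg IsSkewDir SmallField vary)
open T4AveragingDeficitWallBoundary (IsPeriodicCfg periodBox)
open AveragingDeficitPeriodicCounting (IsPeriodicDir)
open AveragingDeficitTwoLevelPrep (prop1Radius twoLevelSmall)
open AveragingDeficitMultiLevelPrep (cavgIter LevelSmall tower)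
open ReplicationRightInverseBound (radSum)
open BlockAverageVaryHolo (nbRad)
open NE3EnergyShapes (IsUnitarySite IsPeriodicSite)
open NE3RightInverseSupLetters (frameC supC)
open NE3HatInvCurlLetters (supCurlC)
open NE3QbarIterCovLiftPrep (cruxC)
open NE3RightInverseSolveLetters (thetaLoc cruxC_nonneg thetaLoc_nonneg cruxC_le_thetaLoc)
open NE3CovariantLineSumsError (Csup Csup_nonneg)
open ShellMeasureAverageProp4General (C1cov C1cov_pos)
open NE7FrameFreeRightInverse (rightInvW0 supC0 supCurlC0 supC_nonneg supC0_nonneg frameC_nonneg)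
open NE3TangentCovariantTower (framePotW)
open NE3.PairLandauB8Avg (relPert)
open NE3ClassRadiusFamily (radIter_radSum_le_of_small)
open NE7MeanZeroGaugeSliceW (energyBlockLandauW)
open SpreadLift (loopRad)
open NE7SliceIterationState (repLog cornerLog)
open NE7SliceIterationStateNL (coarseDatumNL)
open NE7SliceIterationStateNL0 (tangentPartNL0 normalPartNL0 normalPartNL0_eq)
open NE7SliceIterationStateFactsNL (coarseDatumNL_skew_periodic)
open NE7SliceTheoremNL0Curved (slice_theorem_curved_nl0)
open NE7SliceRepresentative (radius_levels levelSmall_pair thetaP_line curvSum_line)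
open NE7SliceRepresentativeNL0Budget (budget_nl0)
open NE7HdecompOfTopNormalised (exp_line)

noncomputable section

variable {d : ℕ} {n : Type*} [Fintype n] [DecidableEq n]

/-! ## §1 Two positivity facts -/

omit [Fintype n] [DecidableEq n] in
/-- `0 ≤ supCurlC0`. [folklore] -/
theorem supCurlC0_nonneg (d L : ℕ) : 0 ≤ supCurlC0 d L := by
  unfold supCurlC0
  have h1 : 0 ≤ supCurlC d L := by
    unfold supCurlC NE3RightInverseSupLetters.frameC; have := NE3QbarIterCovLiftPrep.liftC_nonneg d; positivity
  have h2 := supC_nonneg d L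
  have h3 := frameC_nonneg d L
  positivity

omit [Fintype n] [DecidableEq n] in
/-- `0 < c2′ d L` (`L ≥ 1`). [folklore] -/
theorem c2'_pos (d : ℕ) {L : ℕ} (hL : 1 ≤ L) : 0 < c2' d L := by
  have : (0 : ℝ) < L := by exact_mod_cast (by omega : 0 < L)
  unfold c2'; positivity

/-! ## §2 The (R1″) representative, one smallness hypothesis -/

set_option maxHeartbeats 800000 in
/-- **THE (R1″) REPRESENTATIVE OF A PAIR, ONE SMALLNESS HYPOTHESIS** (dimension `d+1 ≥ 2`, `L ≥ 2`, `b̂ ≥ 0`): `∃ ε₂ > 0, ∃ C_S > 0, ∃ α₀ > 0` (k-free; functions of `d, L, card n, b̂`) with the two α-lines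
`C0·(2α₀) ≤ 1∕3`, `4·(2α₀) ≤ c2′`, such that for every level `k`, torus parameter `N`, unitary `(tower L N (k+1))`-periodic `W`, `U′` with `SmallField W (ε∕M²)`, `SmallField U′ (ε∕M²)`, `0 < ε ≤ ε₂`,
and every unitary `(tower)`-periodic corner-trivial `u₀` with `‖W(b)⁻¹U′^{u₀}(b) − 1‖ ≤ b̂·M·(ε∕M²)`: the class facts (`LevelSmall` at `k`, `k+1`; `cruxC·ε < 1`; `thetaLoc·ε < 1`, `≤ 1∕2`; `ε ≤ 1`; the
def-parameter `hE` of `R₀`), [B7]'s Prop-4 facts at the radius `C_S·ε∕M` (`pdev W < α₀∕M²`, the exponential line, `4C_Sε ≤ c3`, `2048(d+1)C_Sε ≤ 1`), the `hK` line and the ℓ¹ level line `hS1` of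
`NE7SliceDirectLettersNL0`, `C_S·ε ≤ 10⁻⁴`; and a unitary `(tower)`-periodic `u⋆` with the chart `U′^{u⋆} = W·e^{X(u⋆)}`, `M·‖X(u⋆)‖ ≤ C_S·ε`, corners `u⋆(M•z) = e^{h(u⋆) z}` with `‖h(u⋆)‖ ≤ C_S·ε`,
`φ̃(u⋆)` skew and `N`-periodic, THE SLICE CONDITION `X(u⋆) − R₀ φ̃(u⋆) ∈ 𝒯_E(W)` (every proof argument of `rightInvW0`), and **`∀ z, mlog v_{k+1}(X(u⋆)) z = h(u⋆) z`**. [folklore] -/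
theorem slice_representative_nl0 [Nonempty n] (hd : 1 ≤ d) {L : ℕ} (hL : 2 ≤ L) {bh : ℝ} (hbh : 0 ≤ bh) :
    ∃ ε₂ : ℝ, 0 < ε₂ ∧ ∃ CS : ℝ, 0 < CS ∧ ∃ α₀ : ℝ, 0 < α₀ ∧ C0 (d + 1) * (2 * α₀) ≤ 1 / 3 ∧ 4 * (2 * α₀) ≤ c2' (d + 1) L ∧
      ∀ (k N : ℕ) [NeZero N] (W U' : Site (d + 1) → Fin (d + 1) → (Matrix n n ℂ)ˣ) (ε : ℝ),
      0 < ε → ε ≤ ε₂ → IsUnitaryCfg W → IsPeriodicCfg W ((tower L N (k + 1) : ℕ) : ℤ) → SmallField W (ε / ((L : ℝ) ^ (k + 1)) ^ 2) →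
      IsUnitaryCfg U' → IsPeriodicCfg U' ((tower L N (k + 1) : ℕ) : ℤ) → SmallField U' (ε / ((L : ℝ) ^ (k + 1)) ^ 2) →
      ∀ {u₀ : Site (d + 1) → (Matrix n n ℂ)ˣ}, IsUnitarySite u₀ → IsPeriodicSite u₀ ((tower L N (k + 1) : ℕ) : ℤ) → (∀ z : Site (d + 1), u₀ (((L : ℤ) ^ (k + 1)) • z) = 1) →
      (∀ (y : Site (d + 1)) (κ : Fin (d + 1)), ‖(((W y κ)⁻¹ * gaugeAct u₀ U' y κ : (Matrix n n ℂ)ˣ) : Matrix n n ℂ) - 1‖ ≤ bh * (L : ℝ) ^ (k + 1) * (ε / ((L : ℝ) ^ (k + 1)) ^ 2)) →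
      -- the class facts at `W`
      LevelSmall (d + 1) L k (ε / ((L : ℝ) ^ (k + 1)) ^ 2) ∧ LevelSmall (d + 1) L (k + 1) (ε / ((L : ℝ) ^ (k + 1)) ^ 2) ∧
      cruxC (d + 1) L * (((L : ℝ) ^ (k + 1)) ^ 2 * (ε / ((L : ℝ) ^ (k + 1)) ^ 2)) < 1 ∧ thetaLoc (d + 1) L * (((L : ℝ) ^ (k + 1)) ^ 2 * (ε / ((L : ℝ) ^ (k + 1)) ^ 2)) < 1 ∧
      thetaLoc (d + 1) L * (((L : ℝ) ^ (k + 1)) ^ 2 * (ε / ((L : ℝ) ^ (k + 1)) ^ 2)) ≤ 1 / 2 ∧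
      ((L : ℝ) ^ (k + 1)) ^ 2 * (ε / ((L : ℝ) ^ (k + 1)) ^ 2) ≤ 1 ∧
      4 * ((d + 1 : ℕ) : ℝ) ^ 2 * ((L : ℝ) ^ (k + 1) - 1) ^ 2 * (ε / ((L : ℝ) ^ (k + 1)) ^ 2) + 16 * ((d + 1 : ℕ) : ℝ) * loopRad (d + 1) L ((prop1Radius (d + 1) L)^[k] (ε / ((L : ℝ) ^ (k + 1)) ^ 2)) ≤ 1 / 2 ∧
      -- [B7]'s Prop-4 facts at the radius `C_S ε / M`
      pdev W < α₀ * (((L : ℝ) ^ (k + 1))⁻¹) ^ 2 ∧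
      Real.exp (4 * (800 * (((d + 1 : ℕ) : ℝ) + 1) ^ 2 * (((d + 1 : ℕ) : ℝ) + 4)) * α₀) * (1 + 8 * (131072 * (((d + 1 : ℕ) : ℝ) + 1) ^ 2) * ((L : ℝ) ^ (k + 1) * (CS * ε / (L : ℝ) ^ (k + 1)))) ≤ 2 ∧
      4 * ((L : ℝ) ^ (k + 1) * (CS * ε / (L : ℝ) ^ (k + 1))) ≤ c3 (d + 1) L ∧ 2048 * ((d + 1 : ℕ) : ℝ) * ((L : ℝ) ^ (k + 1) * (CS * ε / (L : ℝ) ^ (k + 1))) ≤ 1 ∧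
      16 * (C1cov (d + 1) * (L : ℝ) ^ 2 * Real.sqrt (((d + 1 : ℕ) : ℝ) * (2 * (2 * (L : ℝ)) + 1) ^ (d + 1))) * (L : ℝ) ^ (k + 1) * (CS * ε / (L : ℝ) ^ (k + 1))
        ≤ Real.sqrt ((L : ℝ) ^ 2 / (L : ℝ) ^ (d + 1)) ∧
      (16 * (((d + 1 : ℕ) : ℝ) + 1) * (((d + 1 : ℕ) : ℝ) + 4) * (L : ℝ) ^ 2 * Csup (d + 1) L * (((d + 1 : ℕ) : ℝ) * (2 * (nbRad (d + 1) L : ℝ) + 1) ^ (d + 1)))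
          * radSum (d + 1) L k (ε / ((L : ℝ) ^ (k + 1)) ^ 2) ≤ ((L : ℝ) / (L : ℝ) ^ (d + 1)) / 2 ∧
      CS * ε ≤ 1 / 10000 ∧
      -- the representative
      ∃ ustar : Site (d + 1) → (Matrix n n ℂ)ˣ, IsUnitarySite ustar ∧ IsPeriodicSite ustar ((tower L N (k + 1) : ℕ) : ℤ) ∧
        gaugeAct ustar U' = vary W (repLog W U' ustar) 1 ∧
        (∀ (y : Site (d + 1)) (κ : Fin (d + 1)), (L : ℝ) ^ (k + 1) * ‖repLog W U' ustar y κ‖ ≤ CS * ε) ∧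
        (∀ z : Site (d + 1), ((ustar (((L : ℤ) ^ (k + 1)) • z) : (Matrix n n ℂ)ˣ) : Matrix n n ℂ) = exp (cornerLog L k ustar z)) ∧
        (∀ z : Site (d + 1), ‖cornerLog L k ustar z‖ ≤ CS * ε) ∧
        (IsSkewDir (coarseDatumNL L k W U' ustar) ∧ IsPeriodicDir (coarseDatumNL L k W U' ustar) (N : ℤ)) ∧
        (∀ (hWu' : IsUnitaryCfg W) (hx' : 0 ≤ ε / ((L : ℝ) ^ (k + 1)) ^ 2) (hs' : LevelSmall (d + 1) L k (ε / ((L : ℝ) ^ (k + 1)) ^ 2))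
            (hWx' : SmallField W (ε / ((L : ℝ) ^ (k + 1)) ^ 2)) (hθ' : cruxC (d + 1) L * (((L : ℝ) ^ (k + 1)) ^ 2 * (ε / ((L : ℝ) ^ (k + 1)) ^ 2)) < 1)
            (hE' : 4 * ((d + 1 : ℕ) : ℝ) ^ 2 * ((L : ℝ) ^ (k + 1) - 1) ^ 2 * (ε / ((L : ℝ) ^ (k + 1)) ^ 2)
              + 16 * ((d + 1 : ℕ) : ℝ) * loopRad (d + 1) L ((prop1Radius (d + 1) L)^[k] (ε / ((L : ℝ) ^ (k + 1)) ^ 2)) ≤ 1 / 2)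
            (hφ : IsSkewDir (coarseDatumNL L k W U' ustar)),
          (fun y μ => repLog W U' ustar y μ - rightInvW0 hL k hWu' hx' hs' hWx' N hθ' hE' hφ y μ) ∈ energyBlockLandauW (d := d + 1) (n := n) L N (k + 1) W) ∧
        (∀ z, mlog ((vcov L W (relPert W (repLog W U' ustar)) (k + 1) z : (Matrix n n ℂ)ˣ) : Matrix n n ℂ) = cornerLog L k ustar z) := by
  obtain ⟨K, hK, ε₁, hε₁, hcurved⟩ := slice_theorem_curved_nl0 (n := n) hd hL
  have hL1 : 1 ≤ L := by omega
  have hL2r : (2 : ℝ) ≤ L := by exact_mod_cast hL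
  have hLpos : (0 : ℝ) < L := by linarith
  have hdd1 : (1 : ℝ) ≤ ((d + 1 : ℕ) : ℝ) := by exact_mod_cast (by omega : 1 ≤ d + 1)
  have hdd0 : (0 : ℝ) ≤ ((d + 1 : ℕ) : ℝ) := by linarith
  -- the k-free letters of the budget
  have hfC := frameC_nonneg (d + 1) L
  have hsC := supC0_nonneg (d + 1) L
  have hsCC := supCurlC0_nonneg (d + 1) L
  have hcrux : 0 ≤ cruxC (d + 1) L := cruxC_nonneg (d + 1) L
  have hthl0 : 0 ≤ thetaLoc (d + 1) L := thetaLoc_nonneg (d + 1) L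
  have hT : 0 ≤ twoLevelSmall (d + 1) L := by unfold twoLevelSmall; positivity
  have hC0 : 0 ≤ C0 (d + 1) := (C0_pos (d + 1)).le
  have hc2 : 0 < c2' (d + 1) L := c2'_pos (d + 1) hL1
  have hc3 : 0 < c3 (d + 1) L := c3_pos (d + 1) hL1
  have hCsup := Csup_nonneg (d + 1) L
  have hK₁ : 0 ≤ C1cov (d + 1) * (L : ℝ) ^ 2 * Real.sqrt (((d + 1 : ℕ) : ℝ) * (2 * (2 * (L : ℝ)) + 1) ^ (d + 1)) := by
    have := C1cov_pos (d + 1); positivity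
  have hrK : 0 < Real.sqrt ((L : ℝ) ^ 2 / (L : ℝ) ^ (d + 1)) := Real.sqrt_pos.2 (by positivity)
  have hs₁ : 0 ≤ (16 * (((d + 1 : ℕ) : ℝ) + 1) * (((d + 1 : ℕ) : ℝ) + 4) * (L : ℝ) ^ 2 * Csup (d + 1) L * (((d + 1 : ℕ) : ℝ) * (2 * (nbRad (d + 1) L : ℝ) + 1) ^ (d + 1))) / (L : ℝ) ^ 2 := by
    positivity
  have hr₁ : 0 < ((L : ℝ) / (L : ℝ) ^ (d + 1)) / 2 := by positivity
  have hG : 0 ≤ 56 * ((((d + 1 : ℕ) : ℝ)) * L) ^ 2 + 16 * (131072 * (((d + 1 : ℕ) : ℝ) + 1) ^ 2) * ((((d + 1 : ℕ) : ℝ)) * L) := by positivity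
  obtain ⟨E, hE0, α₀, τ₀, eh, ch, Cδ, CS, Cb, hα₀, hα1, hα2, hα3, hτ₀0, hτ₀1, hτ₀s, hτ₀C, hCδ0, hCSpos, hCbpos, heh, hch, hCδ, hCS, hCb, hbud⟩ :=
    budget_nl0 (K := K) (fC := frameC (d + 1) L) (sC := supC0 (d + 1) L) (sCC := supCurlC0 (d + 1) L) (crx := cruxC (d + 1) L) (thl := thetaLoc (d + 1) L)
      (tls := twoLevelSmall (d + 1) L) (dd := ((d + 1 : ℕ) : ℝ)) (bh := bh) (ε₁ := ε₁) (Lr := (L : ℝ)) (nb := (nbRad (d + 1) L : ℝ))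
      (C0r := C0 (d + 1)) (c2r := c2' (d + 1) L) (c3r := c3 (d + 1) L)
      (G := 56 * ((((d + 1 : ℕ) : ℝ)) * L) ^ 2 + 16 * (131072 * (((d + 1 : ℕ) : ℝ) + 1) ^ 2) * ((((d + 1 : ℕ) : ℝ)) * L))
      (K₁ := C1cov (d + 1) * (L : ℝ) ^ 2 * Real.sqrt (((d + 1 : ℕ) : ℝ) * (2 * (2 * (L : ℝ)) + 1) ^ (d + 1))) (rK := Real.sqrt ((L : ℝ) ^ 2 / (L : ℝ) ^ (d + 1)))
      (s₁ := (16 * (((d + 1 : ℕ) : ℝ) + 1) * (((d + 1 : ℕ) : ℝ) + 4) * (L : ℝ) ^ 2 * Csup (d + 1) L * (((d + 1 : ℕ) : ℝ) * (2 * (nbRad (d + 1) L : ℝ) + 1) ^ (d + 1))) / (L : ℝ) ^ 2)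
      (r₁ := ((L : ℝ) / (L : ℝ) ^ (d + 1)) / 2)
      hK hfC hsC hsCC hcrux hthl0 hT hdd1 hbh hε₁ hLpos.le (Nat.cast_nonneg _) hC0 hc2 hc3 hG hK₁ hrK hs₁ hr₁
  refine ⟨1 / E, by positivity, CS, hCSpos, α₀, hα₀, hα1, by linarith only [hα2], ?_⟩
  intro k N _ W U' ε hε hεE hWu hWP hWx hU'u hU'P hU'x u₀ hu₀ hu₀P hpin hb
  have hε0 : 0 ≤ ε := hε.le
  have hεE1 : ε * E ≤ 1 := by rwa [le_div_iff₀ hE0] at hεE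
  obtain ⟨hε1', hεε₁, hεα, hb64', hls1, hls2, hθline, hCcline, hcrxline, hthlline, hδmaxl, hCδτ, hS4, hSτ, hετ, hPb₁, hP2b, hPS, hc3b₁, hc32b, hc3S, h100b₁, h1002b,
    hC16b₁, hC162b, hsmb₁, hsm2b, hsmS, hKS, hS1l, hτω, hCω⟩ := hbud ε hε hεE1
  have hM0 : (0 : ℝ) < (L : ℝ) ^ (k + 1) := pow_pos hLpos _
  have hM1 : (1 : ℝ) ≤ (L : ℝ) ^ (k + 1) := one_le_pow₀ (by linarith only [hL2r])
  have hx : 0 ≤ ε / ((L : ℝ) ^ (k + 1)) ^ 2 := div_nonneg hε0 (pow_nonneg hM0.le 2)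
  have hMx : ((L : ℝ) ^ (k + 1)) ^ 2 * (ε / ((L : ℝ) ^ (k + 1)) ^ 2) = ε := by field_simp
  -- radius identities
  have hMS : (L : ℝ) ^ (k + 1) * (CS * ε / (L : ℝ) ^ (k + 1)) = CS * ε := by field_simp
  have hMb₁ : (L : ℝ) ^ (k + 1) * (Cb * ε / (L : ℝ) ^ (k + 1)) = Cb * ε := by field_simp
  have hbM : bh * (L : ℝ) ^ (k + 1) * (ε / ((L : ℝ) ^ (k + 1)) ^ 2) = bh * ε / (L : ℝ) ^ (k + 1) := by field_simp
  have hM2b : (L : ℝ) ^ (k + 1) * (2 * (bh * ε / (L : ℝ) ^ (k + 1))) = 2 * (bh * ε) := by field_simp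
  -- the class lines
  obtain ⟨hsk, hsk1⟩ := levelSmall_pair (d := d + 1) hL k hε0 hls1 hls2
  have hθc : cruxC (d + 1) L * (((L : ℝ) ^ (k + 1)) ^ 2 * (ε / ((L : ℝ) ^ (k + 1)) ^ 2)) ≤ 1 / 2 := by rw [hMx]; exact hcrxline
  have hθ : cruxC (d + 1) L * (((L : ℝ) ^ (k + 1)) ^ 2 * (ε / ((L : ℝ) ^ (k + 1)) ^ 2)) < 1 := hθc.trans_lt (by norm_num)
  have hθl2 : thetaLoc (d + 1) L * (((L : ℝ) ^ (k + 1)) ^ 2 * (ε / ((L : ℝ) ^ (k + 1)) ^ 2)) ≤ 1 / 2 := by rw [hMx]; exact hthlline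
  have hθl : thetaLoc (d + 1) L * (((L : ℝ) ^ (k + 1)) ^ 2 * (ε / ((L : ℝ) ^ (k + 1)) ^ 2)) < 1 := hθl2.trans_lt (by norm_num)
  have hεM1 : ((L : ℝ) ^ (k + 1)) ^ 2 * (ε / ((L : ℝ) ^ (k + 1)) ^ 2) ≤ 1 := by rw [hMx]; exact hε1'
  have hθP := thetaP_line (d := d + 1) (by omega) hL k hε0 hsk hθline
  have hEline : 4 * ((d + 1 : ℕ) : ℝ) ^ 2 * ((L : ℝ) ^ (k + 1) - 1) ^ 2 * (ε / ((L : ℝ) ^ (k + 1)) ^ 2)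
      + 16 * ((d + 1 : ℕ) : ℝ) * loopRad (d + 1) L ((prop1Radius (d + 1) L)^[k] (ε / ((L : ℝ) ^ (k + 1)) ^ 2)) ≤ 1 / 2 := by
    have hnn : 0 ≤ 4 * ((d + 1 : ℕ) : ℝ) * ((((d + 1 : ℕ) : ℝ)) - 1) * ((L : ℝ) ^ (k + 1) - 1) ^ 2 * (ε / ((L : ℝ) ^ (k + 1)) ^ 2) := by
      have : 0 ≤ (((d + 1 : ℕ) : ℝ)) - 1 := by linarith only [hdd1]
      positivity
    linarith only [hθP, hnn]
  have hA := curvSum_line (d := d + 1) hL k hε0 hsk hCcline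
  -- pdev
  have hpdev : pdev W ≤ ε / ((L : ℝ) ^ (k + 1)) ^ 2 := by
    unfold pdev
    refine Real.iSup_le (fun p => ?_) hx
    rcases eq_or_ne p.2.1 p.2.2 with h | h
    · have h1 : hol W p.1 (plaqWord p.2.1 p.2.2) = 1 := by
        rw [h, B7Prop1Local.hol_plaqWord_eq, mul_inv_cancel_right, mul_inv_cancel]
      rw [h1, Units.val_one, sub_self, norm_zero]; exact hx
    · exact hWx p.1 p.2.1 p.2.2 h
  have h52 : pdev W < α₀ * (((L : ℝ) ^ (k + 1))⁻¹) ^ 2 := by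
    refine lt_of_le_of_lt hpdev ?_
    rw [inv_pow, ← div_eq_mul_inv]
    exact div_lt_div_of_pos_right (by linarith only [hεα, hε]) (by positivity)
  have hx'P : ε / ((L : ℝ) ^ (k + 1)) ^ 2 < α₀ * (((L : ℝ) ^ (k + 1))⁻¹) ^ 2 := by
    rw [inv_pow, ← div_eq_mul_inv]
    exact div_lt_div_of_pos_right (by linarith only [hεα, hε]) (by positivity)
  -- the exponential lines
  have hs10 : 0 ≤ 4 * (800 * (((d + 1 : ℕ) : ℝ) + 1) ^ 2 * (((d + 1 : ℕ) : ℝ) + 4)) * α₀ := by positivity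
  have hexpb₁ : Real.exp (4 * (800 * (((d + 1 : ℕ) : ℝ) + 1) ^ 2 * (((d + 1 : ℕ) : ℝ) + 4)) * α₀)
      * (1 + 8 * (131072 * (((d + 1 : ℕ) : ℝ) + 1) ^ 2) * ((L : ℝ) ^ (k + 1) * (Cb * ε / (L : ℝ) ^ (k + 1)))) ≤ 2 := by
    rw [hMb₁]; exact exp_line hs10 hα3 (by positivity) hPb₁
  have hexp2b : Real.exp (4 * (800 * (((d + 1 : ℕ) : ℝ) + 1) ^ 2 * (((d + 1 : ℕ) : ℝ) + 4)) * α₀)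
      * (1 + 8 * (131072 * (((d + 1 : ℕ) : ℝ) + 1) ^ 2) * ((L : ℝ) ^ (k + 1) * (2 * (bh * ε / (L : ℝ) ^ (k + 1))))) ≤ 2 := by
    rw [hM2b]; exact exp_line hs10 hα3 (by positivity) hP2b
  have hexpS : Real.exp (4 * (800 * (((d + 1 : ℕ) : ℝ) + 1) ^ 2 * (((d + 1 : ℕ) : ℝ) + 4)) * α₀)
      * (1 + 8 * (131072 * (((d + 1 : ℕ) : ℝ) + 1) ^ 2) * ((L : ℝ) ^ (k + 1) * (CS * ε / (L : ℝ) ^ (k + 1)))) ≤ 2 := by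
    rw [hMS]; exact exp_line hs10 hα3 (by positivity) hPS
  -- the near-representative
  have hb' : ∀ (y : Site (d + 1)) (κ : Fin (d + 1)), ‖(((W y κ)⁻¹ * gaugeAct u₀ U' y κ : (Matrix n n ℂ)ˣ) : Matrix n n ℂ) - 1‖ ≤ bh * ε / (L : ℝ) ^ (k + 1) :=
    fun y κ => (hb y κ).trans (le_of_eq hbM)
  have hbε : bh * ε / (L : ℝ) ^ (k + 1) ≤ bh * ε := div_le_self (mul_nonneg hbh hε0) hM1
  have hb64 : bh * ε / (L : ℝ) ^ (k + 1) ≤ 1 / 64 := by linarith only [hbε, hb64']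
  -- the ceilings
  have h1θ : 1 / 2 ≤ 1 - cruxC (d + 1) L * (((L : ℝ) ^ (k + 1)) ^ 2 * (ε / ((L : ℝ) ^ (k + 1)) ^ 2)) := by linarith only [hθc]
  set G : ℝ := 56 * ((((d + 1 : ℕ) : ℝ)) * L) ^ 2 + 16 * (131072 * (((d + 1 : ℕ) : ℝ) + 1) ^ 2) * ((((d + 1 : ℕ) : ℝ)) * L) with hGdef
  have hXb : (3 + 12 * ((d + 1 : ℕ) : ℝ)) * (L : ℝ) ^ (k + 1) * (2 * (bh * ε / (L : ℝ) ^ (k + 1))) = (3 + 12 * ((d + 1 : ℕ) : ℝ)) * (2 * (bh * ε)) := by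
    rw [mul_assoc, hM2b]
  have hbr : (3 + 12 * ((d + 1 : ℕ) : ℝ)) * (L : ℝ) ^ (k + 1) * (2 * (bh * ε / (L : ℝ) ^ (k + 1))) + 2 * (G * ((L : ℝ) ^ (k + 1) * (2 * (bh * ε / (L : ℝ) ^ (k + 1)))) ^ 2)
      ≤ ε * ((3 + 12 * ((d + 1 : ℕ) : ℝ)) * (2 * bh) + 8 * G * bh ^ 2) := by
    rw [hXb, hM2b]
    have e1 : (3 + 12 * ((d + 1 : ℕ) : ℝ)) * (2 * (bh * ε)) + 2 * (G * (2 * (bh * ε)) ^ 2) = ε * ((3 + 12 * ((d + 1 : ℕ) : ℝ)) * (2 * bh) + 8 * G * bh ^ 2 * ε) := by ring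
    rw [e1]
    have h2 : 8 * G * bh ^ 2 * ε ≤ 8 * G * bh ^ 2 := mul_le_of_le_one_right (by positivity) hε1'
    exact mul_le_mul_of_nonneg_left (by linarith only [h2]) hε0
  have hbr0 : 0 ≤ (3 + 12 * ((d + 1 : ℕ) : ℝ)) * (L : ℝ) ^ (k + 1) * (2 * (bh * ε / (L : ℝ) ^ (k + 1))) + 2 * (G * ((L : ℝ) ^ (k + 1) * (2 * (bh * ε / (L : ℝ) ^ (k + 1)))) ^ 2) := by
    positivity
  have heE : 2 * (bh * ε / (L : ℝ) ^ (k + 1)) + supC0 (d + 1) L / ((L : ℝ) ^ (k + 1) * (1 - cruxC (d + 1) L * (((L : ℝ) ^ (k + 1)) ^ 2 * (ε / ((L : ℝ) ^ (k + 1)) ^ 2))))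
        * ((3 + 12 * ((d + 1 : ℕ) : ℝ)) * (L : ℝ) ^ (k + 1) * (2 * (bh * ε / (L : ℝ) ^ (k + 1))) + 2 * (G * ((L : ℝ) ^ (k + 1) * (2 * (bh * ε / (L : ℝ) ^ (k + 1)))) ^ 2))
      ≤ eh * ε / (L : ℝ) ^ (k + 1) := by
    have hfrac : supC0 (d + 1) L / ((L : ℝ) ^ (k + 1) * (1 - cruxC (d + 1) L * (((L : ℝ) ^ (k + 1)) ^ 2 * (ε / ((L : ℝ) ^ (k + 1)) ^ 2))))
        ≤ supC0 (d + 1) L / ((L : ℝ) ^ (k + 1) * (1 / 2)) :=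
      div_le_div_of_nonneg_left hsC (mul_pos hM0 (by norm_num)) (mul_le_mul_of_nonneg_left h1θ hM0.le)
    have hfr0 : 0 ≤ supC0 (d + 1) L / ((L : ℝ) ^ (k + 1) * (1 / 2)) := by positivity
    calc _ ≤ 2 * (bh * ε / (L : ℝ) ^ (k + 1)) + supC0 (d + 1) L / ((L : ℝ) ^ (k + 1) * (1 / 2)) * (ε * ((3 + 12 * ((d + 1 : ℕ) : ℝ)) * (2 * bh) + 8 * G * bh ^ 2)) := by
          have := mul_le_mul hfrac hbr hbr0 hfr0
          linarith only [this]
      _ = eh * ε / (L : ℝ) ^ (k + 1) := by rw [heh]; field_simp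
  have hcE : (ε / ((L : ℝ) ^ (k + 1)) ^ 2 + ε / ((L : ℝ) ^ (k + 1)) ^ 2 + 48 * (2 * (bh * ε / (L : ℝ) ^ (k + 1))) ^ 2)
        + supCurlC0 (d + 1) L / (((L : ℝ) ^ (k + 1)) ^ 2 * (1 - cruxC (d + 1) L * (((L : ℝ) ^ (k + 1)) ^ 2 * (ε / ((L : ℝ) ^ (k + 1)) ^ 2))))
          * ((3 + 12 * ((d + 1 : ℕ) : ℝ)) * (L : ℝ) ^ (k + 1) * (2 * (bh * ε / (L : ℝ) ^ (k + 1))) + 2 * (G * ((L : ℝ) ^ (k + 1) * (2 * (bh * ε / (L : ℝ) ^ (k + 1)))) ^ 2))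
      ≤ ch * ε / ((L : ℝ) ^ (k + 1)) ^ 2 := by
    have hfrac : supCurlC0 (d + 1) L / (((L : ℝ) ^ (k + 1)) ^ 2 * (1 - cruxC (d + 1) L * (((L : ℝ) ^ (k + 1)) ^ 2 * (ε / ((L : ℝ) ^ (k + 1)) ^ 2))))
        ≤ supCurlC0 (d + 1) L / (((L : ℝ) ^ (k + 1)) ^ 2 * (1 / 2)) :=
      div_le_div_of_nonneg_left hsCC (mul_pos (pow_pos hM0 2) (by norm_num)) (mul_le_mul_of_nonneg_left h1θ (pow_nonneg hM0.le 2))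
    have hfr0 : 0 ≤ supCurlC0 (d + 1) L / (((L : ℝ) ^ (k + 1)) ^ 2 * (1 / 2)) := by positivity
    have hsq : 48 * (2 * (bh * ε / (L : ℝ) ^ (k + 1))) ^ 2 = 192 * bh ^ 2 * (ε * ε) / ((L : ℝ) ^ (k + 1)) ^ 2 := by field_simp; ring
    have hsq' : 192 * bh ^ 2 * (ε * ε) / ((L : ℝ) ^ (k + 1)) ^ 2 ≤ 192 * bh ^ 2 * ε / ((L : ℝ) ^ (k + 1)) ^ 2 := by
      apply div_le_div_of_nonneg_right _ (pow_nonneg hM0.le 2)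
      exact mul_le_mul_of_nonneg_left (mul_le_of_le_one_left hε0 hε1') (by positivity)
    rw [hsq]
    calc _ ≤ ε / ((L : ℝ) ^ (k + 1)) ^ 2 + ε / ((L : ℝ) ^ (k + 1)) ^ 2 + 192 * bh ^ 2 * ε / ((L : ℝ) ^ (k + 1)) ^ 2
          + supCurlC0 (d + 1) L / (((L : ℝ) ^ (k + 1)) ^ 2 * (1 / 2)) * (ε * ((3 + 12 * ((d + 1 : ℕ) : ℝ)) * (2 * bh) + 8 * G * bh ^ 2)) := by
          have := mul_le_mul hfrac hbr hbr0 hfr0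
          linarith only [this, hsq']
      _ = ch * ε / ((L : ℝ) ^ (k + 1)) ^ 2 := by rw [hch]; field_simp; ring
  have hec : G * ((L : ℝ) ^ (k + 1) * (2 * (bh * ε / (L : ℝ) ^ (k + 1)))) ^ 2 ≤ G * (2 * (bh * ε)) ^ 2 := by rw [hM2b]
  have hδ₀ : (eh * ε / (L : ℝ) ^ (k + 1) + (2 * K * (L : ℝ) ^ (k + 1) * (ch * ε / ((L : ℝ) ^ (k + 1)) ^ 2)
          + 8 * K * (((L : ℝ) ^ (k + 1)) ^ 2 * (ε / ((L : ℝ) ^ (k + 1)) ^ 2)) * (frameC (d + 1) L * (L : ℝ) ^ (k + 1) * (eh * ε / (L : ℝ) ^ (k + 1)) + G * (2 * (bh * ε)) ^ 2) / (L : ℝ) ^ (k + 1)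
          + 16 * K * ((d + 1 : ℕ) : ℝ) * (((L : ℝ) ^ (k + 1)) ^ 2 * (ε / ((L : ℝ) ^ (k + 1)) ^ 2)) * (eh * ε / (L : ℝ) ^ (k + 1))))
        + (frameC (d + 1) L * (L : ℝ) ^ (k + 1) * (eh * ε / (L : ℝ) ^ (k + 1)) + G * (2 * (bh * ε)) ^ 2) / (L : ℝ) ^ (k + 1) ≤ Cδ * ε / (L : ℝ) ^ (k + 1) := by
    rw [hMx]
    have e1 : (eh * ε / (L : ℝ) ^ (k + 1) + (2 * K * (L : ℝ) ^ (k + 1) * (ch * ε / ((L : ℝ) ^ (k + 1)) ^ 2)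
          + 8 * K * ε * (frameC (d + 1) L * (L : ℝ) ^ (k + 1) * (eh * ε / (L : ℝ) ^ (k + 1)) + G * (2 * (bh * ε)) ^ 2) / (L : ℝ) ^ (k + 1)
          + 16 * K * ((d + 1 : ℕ) : ℝ) * ε * (eh * ε / (L : ℝ) ^ (k + 1))))
        + (frameC (d + 1) L * (L : ℝ) ^ (k + 1) * (eh * ε / (L : ℝ) ^ (k + 1)) + G * (2 * (bh * ε)) ^ 2) / (L : ℝ) ^ (k + 1)
        = (ε / (L : ℝ) ^ (k + 1)) * (eh * (1 + frameC (d + 1) L + (8 * K * frameC (d + 1) L) * ε + (16 * K * ((d + 1 : ℕ) : ℝ)) * ε)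
            + 2 * K * ch + (8 * K * (ε * ε) + ε) * (4 * G * bh ^ 2)) := by
      field_simp; ring
    have e2 : Cδ * ε / (L : ℝ) ^ (k + 1)
        = (ε / (L : ℝ) ^ (k + 1)) * (eh * (1 + frameC (d + 1) L + 8 * K * frameC (d + 1) L + 16 * K * ((d + 1 : ℕ) : ℝ)) + 2 * K * ch + (8 * K + 1) * (4 * G * bh ^ 2)) := by
      rw [hCδ]; field_simp
    rw [e1, e2]
    have heh0 : 0 ≤ eh := by rw [heh]; positivity
    have h0 : 0 ≤ ε / (L : ℝ) ^ (k + 1) := div_nonneg hε0 hM0.le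
    refine mul_le_mul_of_nonneg_left ?_ h0
    have a1 : (8 * K * frameC (d + 1) L) * ε ≤ 8 * K * frameC (d + 1) L := mul_le_of_le_one_right (by positivity) hε1'
    have a2 : (16 * K * ((d + 1 : ℕ) : ℝ)) * ε ≤ 16 * K * ((d + 1 : ℕ) : ℝ) := mul_le_of_le_one_right (by positivity) hε1'
    have a3 : 8 * K * (ε * ε) + ε ≤ 8 * K + 1 := by
      have : ε * ε ≤ 1 := by nlinarith only [hε0, hε1']
      nlinarith only [this, hε1', hK.le]
    have hin := mul_le_mul_of_nonneg_left (show 1 + frameC (d + 1) L + (8 * K * frameC (d + 1) L) * ε + (16 * K * ((d + 1 : ℕ) : ℝ)) * ε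
        ≤ 1 + frameC (d + 1) L + 8 * K * frameC (d + 1) L + 16 * K * ((d + 1 : ℕ) : ℝ) by linarith only [a1, a2]) heh0
    have hin2 := mul_le_mul_of_nonneg_right a3 (show 0 ≤ 4 * G * bh ^ 2 by positivity)
    linarith only [hin, hin2]
  have hδmax : 6 * ((d + 1 : ℕ) : ℝ) * (L : ℝ) ^ (k + 1) * (Cδ * ε / (L : ℝ) ^ (k + 1)) ≤ 1 / 10000 := by
    have e : 6 * ((d + 1 : ℕ) : ℝ) * (L : ℝ) ^ (k + 1) * (Cδ * ε / (L : ℝ) ^ (k + 1)) = 6 * ((d + 1 : ℕ) : ℝ) * Cδ * ε := by field_simp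
    rw [e]; exact hδmaxl
  have hMδ : (L : ℝ) ^ (k + 1) * (Cδ * ε / (L : ℝ) ^ (k + 1)) ≤ τ₀ := by
    have e : (L : ℝ) ^ (k + 1) * (Cδ * ε / (L : ℝ) ^ (k + 1)) = Cδ * ε := by field_simp
    rw [e]; exact hCδτ
  have hSsum : 2 * (L : ℝ) ^ (k + 1) * (bh * ε / (L : ℝ) ^ (k + 1)) + 24 * ((d + 1 : ℕ) : ℝ) * (L : ℝ) ^ (k + 1) * (Cδ * ε / (L : ℝ) ^ (k + 1)) ≤ CS * ε := by
    have e : 2 * (L : ℝ) ^ (k + 1) * (bh * ε / (L : ℝ) ^ (k + 1)) + 24 * ((d + 1 : ℕ) : ℝ) * (L : ℝ) ^ (k + 1) * (Cδ * ε / (L : ℝ) ^ (k + 1)) = CS * ε := by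
      rw [hCS]; field_simp
    rw [e]
  have hSb : 2 * (CS * ε) + 6 * ((L : ℝ) ^ (k + 1) * (Cδ * ε / (L : ℝ) ^ (k + 1))) ≤ (L : ℝ) ^ (k + 1) * (Cb * ε / (L : ℝ) ^ (k + 1)) := by
    rw [hMb₁, show (L : ℝ) ^ (k + 1) * (Cδ * ε / (L : ℝ) ^ (k + 1)) = Cδ * ε by field_simp, hCb]
    nlinarith only [hCSpos, hε0]
  have h6S : 6 * (CS * ε) ≤ (L : ℝ) ^ (k + 1) * (Cb * ε / (L : ℝ) ^ (k + 1)) := by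
    rw [hMb₁, hCb]; nlinarith only [hCδ0, hε0]
  have h4 : ((L : ℝ) ^ (k + 1)) ^ 2 * (ε / ((L : ℝ) ^ (k + 1)) ^ 2) ≤ τ₀ := by rw [hMx]; exact hετ
  have hω0 : 0 ≤ 4 * G * (Cb * ε) := by positivity
  have hβ : 4 * G * ((L : ℝ) ^ (k + 1) * (Cb * ε / (L : ℝ) ^ (k + 1))) ≤ 4 * G * (Cb * ε) := by rw [hMb₁]
  -- B7's radius lines at `b₁ = C_b ε / M` and `2b = 2 b̂ ε / M`
  have hc₃ : 2 * ((L : ℝ) ^ (k + 1) * (Cb * ε / (L : ℝ) ^ (k + 1))) ≤ c3 (d + 1) L := by rw [hMb₁]; exact hc3b₁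
  have h100 : 100 * ((((d + 1 : ℕ) : ℝ)) * L * ((L : ℝ) ^ (k + 1) * (Cb * ε / (L : ℝ) ^ (k + 1)))) ≤ 1 := by rw [hMb₁]; exact h100b₁
  have hC16 : 16 * (131072 * (((d + 1 : ℕ) : ℝ) + 1) ^ 2) * ((L : ℝ) ^ (k + 1) * (Cb * ε / (L : ℝ) ^ (k + 1))) ≤ 1 := by rw [hMb₁]; exact hC16b₁
  have hsm : 2048 * (((d + 1 : ℕ) : ℝ)) * ((L : ℝ) ^ (k + 1) * (Cb * ε / (L : ℝ) ^ (k + 1))) ≤ 1 := by rw [hMb₁]; exact hsmb₁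
  have hc₃2 : 2 * ((L : ℝ) ^ (k + 1) * (2 * (bh * ε / (L : ℝ) ^ (k + 1)))) ≤ c3 (d + 1) L := by rw [hM2b]; exact hc32b
  have h1002 : 100 * ((((d + 1 : ℕ) : ℝ)) * L * ((L : ℝ) ^ (k + 1) * (2 * (bh * ε / (L : ℝ) ^ (k + 1))))) ≤ 1 := by rw [hM2b]; exact h1002b
  have hC162 : 16 * (131072 * (((d + 1 : ℕ) : ℝ) + 1) ^ 2) * ((L : ℝ) ^ (k + 1) * (2 * (bh * ε / (L : ℝ) ^ (k + 1)))) ≤ 1 := by rw [hM2b]; exact hC162b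
  have hsm2 : 2048 * (((d + 1 : ℕ) : ℝ)) * ((L : ℝ) ^ (k + 1) * (2 * (bh * ε / (L : ℝ) ^ (k + 1)))) ≤ 1 := by rw [hM2b]; exact hsm2b
  -- the representative
  obtain ⟨ustar, hlu, hlP, hgl, hXl, hcl, hhl, hTm, -, hv0, -⟩ := hcurved k N W U' (ε / ((L : ℝ) ^ (k + 1)) ^ 2) hWu hx hsk hWx hθ hEline hWP hU'u hU'P ⟨0, by omega⟩
    (α₀ := α₀) (αP := α₀) (x' := ε / ((L : ℝ) ^ (k + 1)) ^ 2) (b := bh * ε / (L : ℝ) ^ (k + 1)) (b₁ := Cb * ε / (L : ℝ) ^ (k + 1)) (ω := 4 * G * (Cb * ε))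
    hα₀ (by nlinarith only [hα1, hC0, hα₀]) (by linarith only [hα2, hα₀]) h52 hexpb₁ hc₃ h100 hC16 hsm hexp2b hc₃2 h1002 hC162 hsm2
    hα₀ (by nlinarith only [hα1, hC0, hα₀]) (by linarith only [hα2, hα₀]) hx hU'x hx'P hω0 hβ hθP (by rw [hMx]; exact hεε₁) hεM1 hA hθc
    (τ := τ₀) hτ₀0.le hτω hτ₀s hCω h4 h4 hu₀ hu₀P hpin hb' hb64
    (eE := eh * ε / (L : ℝ) ^ (k + 1)) (cE := ch * ε / ((L : ℝ) ^ (k + 1)) ^ 2) (ec := G * (2 * (bh * ε)) ^ 2) (δ₀ := Cδ * ε / (L : ℝ) ^ (k + 1)) (S := CS * ε)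
    heE hcE hec hδ₀ hδmax hMδ hSsum hS4 hSτ hSb h6S
  -- the direct letters' lines at the radius `C_S ε / M`
  have hc₃S : 4 * ((L : ℝ) ^ (k + 1) * (CS * ε / (L : ℝ) ^ (k + 1))) ≤ c3 (d + 1) L := by rw [hMS]; exact hc3S
  have hsmS' : 2048 * ((d + 1 : ℕ) : ℝ) * ((L : ℝ) ^ (k + 1) * (CS * ε / (L : ℝ) ^ (k + 1))) ≤ 1 := by rw [hMS]; exact hsmS
  have hKline : 16 * (C1cov (d + 1) * (L : ℝ) ^ 2 * Real.sqrt (((d + 1 : ℕ) : ℝ) * (2 * (2 * (L : ℝ)) + 1) ^ (d + 1))) * (L : ℝ) ^ (k + 1) * (CS * ε / (L : ℝ) ^ (k + 1))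
      ≤ Real.sqrt ((L : ℝ) ^ 2 / (L : ℝ) ^ (d + 1)) := by
    have e : 16 * (C1cov (d + 1) * (L : ℝ) ^ 2 * Real.sqrt (((d + 1 : ℕ) : ℝ) * (2 * (2 * (L : ℝ)) + 1) ^ (d + 1))) * (L : ℝ) ^ (k + 1) * (CS * ε / (L : ℝ) ^ (k + 1))
        = 16 * (C1cov (d + 1) * (L : ℝ) ^ 2 * Real.sqrt (((d + 1 : ℕ) : ℝ) * (2 * (2 * (L : ℝ)) + 1) ^ (d + 1))) * (CS * ε) := by field_simp
    rw [e]; exact hKS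
  have hS1line : (16 * (((d + 1 : ℕ) : ℝ) + 1) * (((d + 1 : ℕ) : ℝ) + 4) * (L : ℝ) ^ 2 * Csup (d + 1) L * (((d + 1 : ℕ) : ℝ) * (2 * (nbRad (d + 1) L : ℝ) + 1) ^ (d + 1)))
      * radSum (d + 1) L k (ε / ((L : ℝ) ^ (k + 1)) ^ 2) ≤ ((L : ℝ) / (L : ℝ) ^ (d + 1)) / 2 := by
    obtain ⟨e1, -⟩ := radius_levels hL k ε
    have hL2sq : (4 : ℝ) ≤ (L : ℝ) ^ 2 := by nlinarith only [hL2r]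
    have hεL : ε / (L : ℝ) ^ 2 ≤ ε := by
      rw [div_le_iff₀ (by positivity)]; nlinarith only [hε0, hL2sq]
    have hc0 : (0 : ℝ) ≤ 14464 * (((d + 1 : ℕ) : ℝ) + 1) ^ 2 * (((d + 1 : ℕ) : ℝ) + 4) ^ 2 * (L : ℝ) ^ 2 := by positivity
    have hsmallr : 14464 * (((d + 1 : ℕ) : ℝ) + 1) ^ 2 * (((d + 1 : ℕ) : ℝ) + 4) ^ 2 * (L : ℝ) ^ 2 * (8 / 3 * (((L : ℝ) ^ 2) ^ k * (ε / ((L : ℝ) ^ (k + 1)) ^ 2))) ≤ 1 / 2 := by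
      rw [e1]; nlinarith only [mul_le_mul_of_nonneg_left hεL hc0, hls1]
    have hr := (radIter_radSum_le_of_small (d := d + 1) hL k hx hsmallr).2
    rw [e1] at hr
    set s1 : ℝ := 16 * (((d + 1 : ℕ) : ℝ) + 1) * (((d + 1 : ℕ) : ℝ) + 4) * (L : ℝ) ^ 2 * Csup (d + 1) L * (((d + 1 : ℕ) : ℝ) * (2 * (nbRad (d + 1) L : ℝ) + 1) ^ (d + 1)) with hs1
    have hs1_0 : 0 ≤ s1 := by rw [hs1]; positivity
    have e2 : s1 / (L : ℝ) ^ 2 * (8 / 3 * ε) = s1 * (8 / 3 * (ε / (L : ℝ) ^ 2)) := by field_simp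
    calc s1 * radSum (d + 1) L k (ε / ((L : ℝ) ^ (k + 1)) ^ 2) ≤ s1 * (8 / 3 * (ε / (L : ℝ) ^ 2)) := mul_le_mul_of_nonneg_left hr hs1_0
      _ = s1 / (L : ℝ) ^ 2 * (8 / 3 * ε) := e2.symm
      _ ≤ ((L : ℝ) / (L : ℝ) ^ (d + 1)) / 2 := hS1l
  -- `φ̃(u⋆)` is skew and `N`-periodic (the working-region facts at the radius `b₁ = C_b ε / M ≥ ‖X(u⋆)‖`)
  have hSM : CS * ε / (L : ℝ) ^ (k + 1) ≤ CS * ε := div_le_self (mul_nonneg hCSpos.le hε0) hM1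
  have hXl' : ∀ y κ, ‖repLog W U' ustar y κ‖ ≤ CS * ε / (L : ℝ) ^ (k + 1) := fun y κ => by rw [le_div_iff₀ hM0, mul_comm]; exact hXl y κ
  have hX8 : ∀ y κ, ‖repLog W U' ustar y κ‖ ≤ 1 / 8 := fun y κ => ((hXl' y κ).trans hSM).trans (by linarith only [hS4])
  have hh8 : ∀ z, ‖cornerLog L k ustar z‖ ≤ 1 / 8 := fun z => (hhl z).trans (by linarith only [hS4])
  have hCSCb : CS * ε ≤ Cb * ε := by rw [hCb]; nlinarith only [hCSpos, hCδ0, hε0]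
  have hXb₁ : ∀ y κ, ‖repLog W U' ustar y κ‖ ≤ Cb * ε / (L : ℝ) ^ (k + 1) := fun y κ => (hXl' y κ).trans (div_le_div_of_nonneg_right hCSCb hM0.le)
  have hb₁0 : 0 ≤ Cb * ε / (L : ℝ) ^ (k + 1) := by positivity
  have hφP := coarseDatumNL_skew_periodic hL k hWu hx hsk hWx N U' hWP hU'u hU'P hlu hlP hgl hX8 hcl hh8 (Nat.succ_le_succ (Nat.zero_le d)) hα₀
    (by nlinarith only [hα1, hC0, hα₀]) (by linarith only [hα2, hα₀]) h52 hb₁0 hXb₁ hexpb₁ hc₃ hsm hα₀ (by nlinarith only [hα1, hC0, hα₀]) (by linarith only [hα2, hα₀]) hx hU'x hx'P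
  refine ⟨hsk, hsk1, hθ, hθl, hθl2, hεM1, hEline, h52, hexpS, hc₃S, hsmS', hKline, hS1line, hS4, ustar, hlu, hlP, hgl, hXl, hcl, hhl, hφP, fun hWu' hx' hs' hWx' hθ' hE' hφ => ?_, hv0⟩
  have e : (fun y μ => repLog W U' ustar y μ - rightInvW0 hL k hWu' hx' hs' hWx' N hθ' hE' hφ y μ) = tangentPartNL0 hL k hWu hx hsk hWx N hθ hEline U' ustar := by
    funext y μ; simp only [tangentPartNL0, normalPartNL0_eq hL k hWu hx hsk hWx N hθ hEline U' hφ]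
  rw [e]; exact hTm

end

end Summit.QuantumFields.BalabanUV.T4Continuum.NE7SliceRepresentativeNL0
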